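import Mathlib
import Literature.Probability.LatticeModels.IsingConsistency
import Literature.Probability.LatticeModels.IsingDecoration
import Literature.Probability.LatticeModels.GibbsSpecificationProofs
import HarnessLib

/-!
# Detailed balance for single-site flips implies invariance under the Gibbs kernel

Finite-volume Ising model `μ^η_{Λ;β,0}` of `Literature.Probability.LatticeModels.IsingModel` on a
locally finite graph, zero field, `+` boundary condition outside a finite volume `Λ`. For
`Λ' ⊆ Λ` and a weight `ρ` on the configurations of `Λ` satisfying *detailed balance* for the
heat-bath flip at every site `i` of `Λ'`, `ρ(τ) e^{-β σ_i S_i} = ρ(τ^i) e^{+β σ_i S_i}`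
(`σ = τ ∨ (+)`, `S_i = ∑_{y∼i} σ_y`, `τ^i` the flip of `τ` at `i`), the measure `∑_τ ρ(τ) δ_{τ∨(+)}`
is invariant under the Gibbs kernel of `Λ'`: `∑_τ ρ(τ) ⟨g⟩^{τ ∨ (+)}_{Λ';β,0} = ∑_τ ρ(τ) g(τ ∨ (+))`
(`sum_mul_isingExpect_fixed_eq_of_balance`; Friedli–Velenik 2017, Lemma 6.7, read backwards).
Proof: split `τ = (τ₁, τ₂)` along `Λ = Λ' ⊔ (Λ ∖ Λ')` as in `sum_isingWeight_fixed_eq_sum_sum`;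
the weight `w(τ₁; τ₂)` of `Λ'` with boundary condition `τ₂ ∨ (+)` satisfies the same balance
identity (`isingWeight_update_neg_mul_exp`, via `isingWeight_fixed_eq_mul` over `{i} ⊆ Λ'` and
`isingWeight_singleton`), so `ρ / w` is invariant under every flip inside `Λ'`
(`div_isingWeight_update_neg_of_balance`), hence `ρ(τ₁, τ₂) = c(τ₂) w(τ₁; τ₂)`
(`apply_eq_of_forall_update_neg`, `eq_div_mul_isingWeight_of_balance`); both sides then equal
`∑_{τ₂} c(τ₂) ∑_{τ₁} w(τ₁; τ₂) g(τ₁ ∨ τ₂ ∨ (+))` by `isingExpect_eq_sum_div`, the boundary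
conditions `τ ∨ (+)` and `τ₂ ∨ (+)` agreeing off `Λ'` (`isingMeasure_fixed_congr_of_eqOn_compl`).
Reference: S. Friedli, Y. Velenik, *Statistical Mechanics of Lattice Systems* (CUP 2017), Lemma 6.7.
-/

noncomputable section

namespace Summit.CriticalPhenomena.Ising3DConformalLimit.Theorems

open Literature.Probability.LatticeModels MeasureTheory Finset

variable {V : Type*} [DecidableEq V] (G : SimpleGraph V) [G.LocallyFinite]

/-! ### Flip invariance on a finite spin space -/

/-- A function of finitely many `±1` spins which is invariant under every single-site flip
`τ ↦ τ^i` is constant: any configuration is reached from any other by finitely many flips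
(induction on the set of sites where they differ). [folklore] -/
theorem apply_eq_of_forall_update_neg {ι R : Type*} [Fintype ι] [DecidableEq ι]
    {F : (ι → ℤˣ) → R} (hF : ∀ (i : ι) (τ : ι → ℤˣ), F (Function.update τ i (-τ i)) = F τ)
    (τ τ' : ι → ℤˣ) : F τ = F τ' := by
  suffices h : ∀ (s : Finset ι) (σ : ι → ℤˣ), (∀ j ∉ s, σ j = τ' j) → F σ = F τ' from
    h Finset.univ τ fun j hj => absurd (Finset.mem_univ j) hj
  intro s
  induction s using Finset.induction_on with
  | empty => exact fun σ hσ => congrArg F (funext fun j => hσ j (Finset.notMem_empty j))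
  | insert a s _ ih =>
    intro σ hσ
    by_cases ha : σ a = τ' a
    · refine ih σ fun j hj => ?_
      by_cases hja : j = a
      · rw [hja]
        exact ha
      · exact hσ j fun hm => (Finset.mem_insert.1 hm).elim hja hj
    · rw [← hF a σ]
      refine ih _ fun j hj => ?_
      by_cases hja : j = a
      · rw [hja, Function.update_self]
        exact (Int.units_ne_iff_eq_neg.1 (Ne.symm ha)).symm
      · rw [Function.update_of_ne hja]
        exact hσ j fun hm => (Finset.mem_insert.1 hm).elim hja hj

/-! ### The boundary condition is read only off the volume -/

/-- `⟨f⟩^ζ_{Λ;β,h}` depends on the boundary condition `ζ` only through `ζ|_{Λᶜ}`: the two Gibbs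
measures coincide (`isingMeasure_fixed_congr_of_eqOn_compl`), so do all expectations, with no
locality or measurability assumption on `f` (Friedli–Velenik 2017, Lemma 6.7: the kernel
`μ^·_Λ(f)` is `𝓕_{Λᶜ}`-measurable). [cite: FriedliVelenik2017, Lemma 6.7] -/
theorem isingExpect_fixed_congr_of_eqOn_compl (Λ : Finset V) (β h : ℝ) {ζ ζ' : SpinConfig V}
    (hζ : ∀ x ∉ Λ, ζ x = ζ' x) (f : SpinConfig V → ℝ) :
    isingExpect G Λ β h (.fixed ζ) f = isingExpect G Λ β h (.fixed ζ') f := by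
  unfold isingExpect
  rw [Measure.ext fun A hA => isingMeasure_fixed_congr_of_eqOn_compl G Λ β h hζ hA]

/-! ### Step 1: the Gibbs weight satisfies detailed balance for single-site flips -/

/-- **Detailed balance of the Boltzmann weights under one heat-bath flip** (zero field). For a
volume `Λ`, a fixed boundary condition `η`, a configuration `τ` and a site `i ∈ Λ`, with
`σ = τ ∨ η`, `s = σ_i` and `S = ∑_{y ∼ i} σ_y`:
`w^η_{Λ;β,0}(τ^i) · e^{β s S} = w^η_{Λ;β,0}(τ) · e^{-β s S}`, i.e. `w(τ^i)/w(τ) = e^{-2β s S}`: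
by the two-step factorisation `isingWeight_fixed_eq_mul` over `{i} ⊆ Λ` the weight is a factor not
reading the spin at `i` times the one-site weight `e^{β σ_i ∑_{y∼i} σ_y}` (`isingWeight_singleton`)
(Friedli–Velenik 2017, Lemma 6.7, eq. (6.10), with `Δ = {i}`).
[cite: FriedliVelenik2017, Lemma 6.7] -/
theorem isingWeight_update_neg_mul_exp {Λ : Finset V} (β : ℝ) (η : SpinConfig V)
    (τ : ↥Λ → ℤˣ) (i : ↥Λ) :
    isingWeight G Λ β 0 (.fixed η) (Function.update τ i (-τ i)) *
        Real.exp (β * spinAt (i : V) (glue Λ τ (.fixed η)) *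
          ∑ y ∈ G.neighborFinset (i : V), spinAt y (glue Λ τ (.fixed η))) =
      isingWeight G Λ β 0 (.fixed η) τ *
        Real.exp (-(β * spinAt (i : V) (glue Λ τ (.fixed η)) *
          ∑ y ∈ G.neighborFinset (i : V), spinAt y (glue Λ τ (.fixed η)))) := by
  have hsub : ({(i : V)} : Finset V) ⊆ Λ := Finset.singleton_subset_iff.2 i.2
  -- off `i` the flipped configuration agrees with `τ`
  have hrest : (fun x : ↥(Λ \ {(i : V)}) =>
      Function.update τ i (-τ i) ⟨x, (Finset.mem_sdiff.1 x.2).1⟩) =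
      fun x : ↥(Λ \ {(i : V)}) => τ ⟨x, (Finset.mem_sdiff.1 x.2).1⟩ := by
    funext x
    exact Function.update_of_ne (fun h => (Finset.mem_sdiff.1 x.2).2
      (Finset.mem_singleton.2 (congrArg Subtype.val h :))) _ _
  -- the neighbours of `i` and the spin at `i`, read from the two-step gluing
  have hS : ∑ y ∈ G.neighborFinset (i : V), spinAt y (glue Λ τ (.fixed η)) =
      ∑ y ∈ G.neighborFinset (i : V), spinAt y
        (glue (Λ \ {(i : V)}) (fun x => τ ⟨x, (Finset.mem_sdiff.1 x.2).1⟩) (.fixed η)) := by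
    refine Finset.sum_congr rfl fun y hy => ?_
    have hyi : y ∉ ({(i : V)} : Finset V) := fun h =>
      ((SimpleGraph.mem_neighborFinset G (i : V) y).1 hy).ne (Finset.mem_singleton.1 h).symm
    rw [glue_fixed_eq_glue_glue hsub η τ, spinAt, spinAt, glue_apply_of_notMem _ _ _ hyi,
      BoundaryCondition.outside_fixed]
  have hs : spinAt (i : V) (glue Λ τ (.fixed η)) = (((τ i : ℤˣ) : ℤ) : ℝ) := by
    simp [spinAt]
  rw [hS, hs, isingWeight_fixed_eq_mul G hsub η β 0 (Function.update τ i (-τ i)), hrest,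
    isingWeight_fixed_eq_mul G hsub η β 0 τ, isingWeight_singleton, isingWeight_singleton]
  simp only [Subtype.coe_eta, Function.update_self, Units.val_neg, Int.cast_neg, mul_assoc,
    ← Real.exp_add]
  congr 1
  ring

/-! ### Step 2: balance makes `ρ / w` flip-invariant -/

/-- If a weight `ρ` on the configurations of `Λ` satisfies detailed balance for the heat-bath
flip at the site `i` (boundary condition `η`, zero field), then `ρ / w^η_{Λ;β,0}` is invariant
under the flip at `i`: both `ρ` and the Boltzmann weight `w` change by the same factor
`e^{-2β σ_i ∑_{y∼i} σ_y}` (`isingWeight_update_neg_mul_exp`) (Friedli–Velenik 2017, Lemma 6.7).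
[cite: FriedliVelenik2017, Lemma 6.7] -/
theorem div_isingWeight_update_neg_of_balance {Λ : Finset V} (β : ℝ) (η : SpinConfig V)
    (ρ : (↥Λ → ℤˣ) → ℝ) {i : ↥Λ}
    (hbal : ∀ τ : ↥Λ → ℤˣ,
      ρ τ * Real.exp (-(β * spinAt (i : V) (glue Λ τ (.fixed η)) *
          ∑ y ∈ G.neighborFinset (i : V), spinAt y (glue Λ τ (.fixed η)))) =
        ρ (Function.update τ i (-τ i)) * Real.exp (β * spinAt (i : V) (glue Λ τ (.fixed η)) *
          ∑ y ∈ G.neighborFinset (i : V), spinAt y (glue Λ τ (.fixed η))))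
    (τ : ↥Λ → ℤˣ) :
    ρ (Function.update τ i (-τ i)) / isingWeight G Λ β 0 (.fixed η) (Function.update τ i (-τ i)) =
      ρ τ / isingWeight G Λ β 0 (.fixed η) τ := by
  have hw := isingWeight_update_neg_mul_exp G β η τ i
  have hb := hbal τ
  rw [div_eq_div_iff (isingWeight_pos G Λ β 0 _ _).ne' (isingWeight_pos G Λ β 0 _ _).ne']
  refine mul_right_cancel₀ (Real.exp_ne_zero (β * spinAt (i : V) (glue Λ τ (.fixed η)) *
    ∑ y ∈ G.neighborFinset (i : V), spinAt y (glue Λ τ (.fixed η)))) ?_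
  linear_combination -(isingWeight G Λ β 0 (.fixed η) τ) * hb - ρ τ * hw

/-! ### Step 3: balance at every site makes `ρ` proportional to the Gibbs weight -/

/-- If a weight `ρ` on the configurations of `Λ` satisfies detailed balance for the heat-bath
flip at *every* site of `Λ` (boundary condition `η`, zero field), then `ρ` is proportional to
the Boltzmann weight: `ρ(τ) = (ρ(+)/w(+)) · w^η_{Λ;β,0}(τ)` — the flip-invariant ratio `ρ / w`
(`div_isingWeight_update_neg_of_balance`) is constant (`apply_eq_of_forall_update_neg`)
(Friedli–Velenik 2017, Lemma 6.7). [cite: FriedliVelenik2017, Lemma 6.7] -/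
theorem eq_div_mul_isingWeight_of_balance {Λ : Finset V} (β : ℝ) (η : SpinConfig V)
    (ρ : (↥Λ → ℤˣ) → ℝ)
    (hbal : ∀ (i : ↥Λ) (τ : ↥Λ → ℤˣ),
      ρ τ * Real.exp (-(β * spinAt (i : V) (glue Λ τ (.fixed η)) *
          ∑ y ∈ G.neighborFinset (i : V), spinAt y (glue Λ τ (.fixed η)))) =
        ρ (Function.update τ i (-τ i)) * Real.exp (β * spinAt (i : V) (glue Λ τ (.fixed η)) *
          ∑ y ∈ G.neighborFinset (i : V), spinAt y (glue Λ τ (.fixed η))))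
    (τ : ↥Λ → ℤˣ) :
    ρ τ = ρ 1 / isingWeight G Λ β 0 (.fixed η) 1 * isingWeight G Λ β 0 (.fixed η) τ := by
  have hF : ρ τ / isingWeight G Λ β 0 (.fixed η) τ = ρ 1 / isingWeight G Λ β 0 (.fixed η) 1 :=
    apply_eq_of_forall_update_neg (F := fun τ => ρ τ / isingWeight G Λ β 0 (.fixed η) τ)
      (fun i τ => div_isingWeight_update_neg_of_balance G β η ρ (hbal i) τ) τ 1
  rw [← hF, div_mul_cancel₀ _ (isingWeight_pos G Λ β 0 _ τ).ne']

/-! ### Step 4: invariance under the Gibbs kernel of a subvolume -/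

/-- **Detailed balance for single-site flips implies invariance under the Gibbs kernel.** Let
`Λ' ⊆ Λ` be finite volumes, glue the configurations `τ` of `Λ` with the `+` boundary condition,
and let `ρ` be a weight on them satisfying detailed balance for the heat-bath flip at every site
of `Λ'` (zero field): `ρ(τ) e^{-β σ_i ∑_{y∼i} σ_y} = ρ(τ^i) e^{β σ_i ∑_{y∼i} σ_y}`, `σ = τ ∨ (+)`.
Then for every measurable `g`, `∑_τ ρ(τ) ⟨g⟩^{τ ∨ (+)}_{Λ';β,0} = ∑_τ ρ(τ) g(τ ∨ (+))`, i.e. the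
measure `∑_τ ρ(τ) δ_{τ∨(+)}` is invariant under the kernel `μ^·_{Λ';β,0}`. Proof: splitting
`τ = (τ₁, τ₂)` along `Λ' ⊔ (Λ ∖ Λ')` (`sum_isingWeight_fixed_eq_sum_sum`), balance forces
`ρ(τ₁, τ₂) = c(τ₂) w^{τ₂ ∨ (+)}_{Λ'}(τ₁)` (`eq_div_mul_isingWeight_of_balance`), and both sides
equal `∑_{τ₂} c(τ₂) ∑_{τ₁} w(τ₁) g(τ₁ ∨ τ₂ ∨ (+))` (`isingExpect_eq_sum_div`) (Friedli–Velenik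
2017, Lemma 6.7, eqs. (6.5)–(6.10), run backwards). [cite: FriedliVelenik2017, Lemma 6.7] -/
theorem sum_mul_isingExpect_fixed_eq_of_balance {Λ' Λ : Finset V} (hsub : Λ' ⊆ Λ) (β : ℝ)
    (ρ : (↥Λ → ℤˣ) → ℝ)
    (hbal : ∀ i : ↥Λ, (i : V) ∈ Λ' → ∀ τ : ↥Λ → ℤˣ,
      ρ τ * Real.exp (-(β * spinAt (i : V) (glue Λ τ .plus) *
          ∑ y ∈ G.neighborFinset (i : V), spinAt y (glue Λ τ .plus))) =
        ρ (Function.update τ i (-τ i)) * Real.exp (β * spinAt (i : V) (glue Λ τ .plus) *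
          ∑ y ∈ G.neighborFinset (i : V), spinAt y (glue Λ τ .plus)))
    {g : SpinConfig V → ℝ} (hg : Measurable g) :
    ∑ τ : ↥Λ → ℤˣ, ρ τ * isingExpect G Λ' β 0 (.fixed (glue Λ τ .plus)) g =
      ∑ τ : ↥Λ → ℤˣ, ρ τ * g (glue Λ τ .plus) := by
  simp only [BoundaryCondition.plus] at hbal ⊢
  -- restriction maps and the splitting equivalence, as in `sum_isingWeight_fixed_eq_sum_sum`
  let r₁ : (↥Λ → ℤˣ) → (↥Λ' → ℤˣ) := fun τ x => τ ⟨x, hsub x.2⟩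
  let r₂ : (↥Λ → ℤˣ) → (↥(Λ \ Λ') → ℤˣ) := fun τ x => τ ⟨x, (Finset.mem_sdiff.1 x.2).1⟩
  let eqv : (↥Λ → ℤˣ) ≃ (↥Λ' → ℤˣ) × (↥(Λ \ Λ') → ℤˣ) :=
    { toFun := fun τ => (r₁ τ, r₂ τ)
      invFun := fun p x => if hx : (x : V) ∈ Λ' then p.1 ⟨x, hx⟩
        else p.2 ⟨x, Finset.mem_sdiff.2 ⟨x.2, hx⟩⟩
      left_inv := fun τ => by
        funext x
        by_cases hx : (x : V) ∈ Λ' <;> simp [r₁, r₂, hx]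
      right_inv := fun p => by
        ext x
        · simp [r₁, x.2]
        · have hx : (x : V) ∉ Λ' := (Finset.mem_sdiff.1 x.2).2
          simp [r₂, hx] }
  have h1 : ∀ τ₁ τ₂, r₁ (eqv.symm (τ₁, τ₂)) = τ₁ := fun τ₁ τ₂ =>
    congrArg Prod.fst (eqv.apply_symm_apply (τ₁, τ₂))
  have h2 : ∀ τ₁ τ₂, r₂ (eqv.symm (τ₁, τ₂)) = τ₂ := fun τ₁ τ₂ =>
    congrArg Prod.snd (eqv.apply_symm_apply (τ₁, τ₂))
  -- gluing in two steps: `τ ∨ (+) = τ₁ ∨ (τ₂ ∨ (+))`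
  have hglue : ∀ τ₁ τ₂, glue Λ (eqv.symm (τ₁, τ₂)) (.fixed 1) =
      glue Λ' τ₁ (.fixed (glue (Λ \ Λ') τ₂ (.fixed 1))) := fun τ₁ τ₂ => by
    have hc := glue_fixed_eq_glue_glue hsub 1 (eqv.symm (τ₁, τ₂))
    change glue Λ (eqv.symm (τ₁, τ₂)) (.fixed 1) = glue Λ' (r₁ (eqv.symm (τ₁, τ₂)))
      (.fixed (glue (Λ \ Λ') (r₂ (eqv.symm (τ₁, τ₂))) (.fixed 1))) at hc
    rwa [h1, h2] at hc
  -- a flip at a site of `Λ'` is a flip of the big configuration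
  have hflip : ∀ τ₁ τ₂ (i : ↥Λ'), eqv.symm (Function.update τ₁ i (-τ₁ i), τ₂) =
      Function.update (eqv.symm (τ₁, τ₂)) ⟨i, hsub i.2⟩ (-τ₁ i) := fun τ₁ τ₂ i => by
    rw [Equiv.symm_apply_eq]
    refine Prod.ext (funext fun x => ?_) (funext fun x => ?_)
    · change Function.update τ₁ i (-τ₁ i) x =
        Function.update (eqv.symm (τ₁, τ₂)) ⟨i, hsub i.2⟩ (-τ₁ i) ⟨x, hsub x.2⟩
      by_cases hx : x = i
      · rw [hx, Function.update_self, Function.update_self]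
      · have hxi : (⟨(x : V), hsub x.2⟩ : ↥Λ) ≠ ⟨i, hsub i.2⟩ := fun h =>
          hx (Subtype.ext (Subtype.mk.inj h))
        rw [Function.update_of_ne hx, Function.update_of_ne hxi]
        exact (congrFun (h1 τ₁ τ₂) x).symm
    · change τ₂ x = Function.update (eqv.symm (τ₁, τ₂)) ⟨i, hsub i.2⟩ (-τ₁ i)
        ⟨x, (Finset.mem_sdiff.1 x.2).1⟩
      have hxi : (⟨(x : V), (Finset.mem_sdiff.1 x.2).1⟩ : ↥Λ) ≠ ⟨i, hsub i.2⟩ := fun h =>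
        (Finset.mem_sdiff.1 x.2).2 (by
          rw [show (x : V) = i from Subtype.mk.inj h]
          exact i.2)
      rw [Function.update_of_ne hxi]
      exact (congrFun (h2 τ₁ τ₂) x).symm
  -- Step 2 input: balance of `τ₁ ↦ ρ(τ₁, τ₂)` at every site of `Λ'`, boundary condition `τ₂ ∨ (+)`
  have hbal' : ∀ (τ₂ : ↥(Λ \ Λ') → ℤˣ) (i : ↥Λ') (τ₁ : ↥Λ' → ℤˣ),
      ρ (eqv.symm (τ₁, τ₂)) *
          Real.exp (-(β * spinAt (i : V) (glue Λ' τ₁ (.fixed (glue (Λ \ Λ') τ₂ (.fixed 1)))) *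
            ∑ y ∈ G.neighborFinset (i : V),
              spinAt y (glue Λ' τ₁ (.fixed (glue (Λ \ Λ') τ₂ (.fixed 1)))))) =
        ρ (eqv.symm (Function.update τ₁ i (-τ₁ i), τ₂)) *
          Real.exp (β * spinAt (i : V) (glue Λ' τ₁ (.fixed (glue (Λ \ Λ') τ₂ (.fixed 1)))) *
            ∑ y ∈ G.neighborFinset (i : V),
              spinAt y (glue Λ' τ₁ (.fixed (glue (Λ \ Λ') τ₂ (.fixed 1))))) := by
    intro τ₂ i τ₁
    have hb := hbal ⟨i, hsub i.2⟩ i.2 (eqv.symm (τ₁, τ₂))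
    have hi : eqv.symm (τ₁, τ₂) ⟨i, hsub i.2⟩ = τ₁ i := congrFun (h1 τ₁ τ₂) i
    rw [hglue, hi] at hb
    rw [hflip]
    exact hb
  -- Step 3: `ρ(τ₁, τ₂) = c(τ₂) · w^{τ₂ ∨ (+)}_{Λ'}(τ₁)`
  obtain ⟨c, hc⟩ : ∃ c : (↥(Λ \ Λ') → ℤˣ) → ℝ, ∀ τ₁ τ₂, ρ (eqv.symm (τ₁, τ₂)) =
      c τ₂ * isingWeight G Λ' β 0 (.fixed (glue (Λ \ Λ') τ₂ (.fixed 1))) τ₁ :=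
    ⟨fun τ₂ => ρ (eqv.symm (1, τ₂)) / isingWeight G Λ' β 0 (.fixed (glue (Λ \ Λ') τ₂ (.fixed 1))) 1,
      fun τ₁ τ₂ => eq_div_mul_isingWeight_of_balance G β _ (fun τ₁ => ρ (eqv.symm (τ₁, τ₂)))
        (hbal' τ₂) τ₁⟩
  -- the boundary conditions `τ₁ ∨ τ₂ ∨ (+)` and `τ₂ ∨ (+)` agree off `Λ'`
  have hE : ∀ (τ₁ : ↥Λ' → ℤˣ) (τ₂ : ↥(Λ \ Λ') → ℤˣ),
      isingExpect G Λ' β 0 (.fixed (glue Λ' τ₁ (.fixed (glue (Λ \ Λ') τ₂ (.fixed 1))))) g =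
        isingExpect G Λ' β 0 (.fixed (glue (Λ \ Λ') τ₂ (.fixed 1))) g := fun τ₁ τ₂ =>
    isingExpect_fixed_congr_of_eqOn_compl G Λ' β 0 (fun x hx => by
      rw [glue_apply_of_notMem _ _ _ hx, BoundaryCondition.outside_fixed]) g
  -- Step 4: split both sums along `eqv` and compare the inner sums
  have hsplit : ∀ Φ : (↥Λ → ℤˣ) → ℝ, ∑ τ, Φ τ = ∑ τ₂, ∑ τ₁, Φ (eqv.symm (τ₁, τ₂)) := fun Φ => by
    rw [← Equiv.sum_comp eqv.symm, Fintype.sum_prod_type_right]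
  rw [hsplit (fun τ => ρ τ * isingExpect G Λ' β 0 (.fixed (glue Λ τ (.fixed 1))) g),
    hsplit (fun τ => ρ τ * g (glue Λ τ (.fixed 1)))]
  refine Finset.sum_congr rfl fun τ₂ _ => ?_
  have hZ : isingPartitionFunction G Λ' β 0 (.fixed (glue (Λ \ Λ') τ₂ (.fixed 1))) ≠ 0 :=
    (isingPartitionFunction_pos G Λ' β 0 _).ne'
  have hEZ := isingExpect_eq_sum_div G Λ' 0 (.fixed (glue (Λ \ Λ') τ₂ (.fixed 1))) β hg
  rw [eq_div_iff hZ, isingPartitionFunction, Finset.mul_sum] at hEZ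
  calc ∑ τ₁, ρ (eqv.symm (τ₁, τ₂)) *
          isingExpect G Λ' β 0 (.fixed (glue Λ (eqv.symm (τ₁, τ₂)) (.fixed 1))) g
      = c τ₂ * ∑ τ₁, isingExpect G Λ' β 0 (.fixed (glue (Λ \ Λ') τ₂ (.fixed 1))) g *
          isingWeight G Λ' β 0 (.fixed (glue (Λ \ Λ') τ₂ (.fixed 1))) τ₁ := by
        rw [Finset.mul_sum]
        exact Finset.sum_congr rfl fun τ₁ _ => by rw [hglue, hE, hc]; ring
    _ = c τ₂ * ∑ τ₁, isingWeight G Λ' β 0 (.fixed (glue (Λ \ Λ') τ₂ (.fixed 1))) τ₁ *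
          g (glue Λ' τ₁ (.fixed (glue (Λ \ Λ') τ₂ (.fixed 1)))) := by rw [hEZ]
    _ = ∑ τ₁, ρ (eqv.symm (τ₁, τ₂)) * g (glue Λ (eqv.symm (τ₁, τ₂)) (.fixed 1)) := by
        rw [Finset.mul_sum]
        exact Finset.sum_congr rfl fun τ₁ _ => by rw [hglue, hc]; ring

/-- **Registered sub-goal `sum_mul_isingExpect_fixed_eq_of_balance_zd3` of item
stmt-CriticalPhenomena-5504** (the `ℤ³` instance of `sum_mul_isingExpect_fixed_eq_of_balance`,
one line, fully qualified). [folklore] -/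
theorem sum_mul_isingExpect_fixed_eq_of_balance_zd3 : ∀ (Λ' Λ : Finset (Literature.Probability.LatticeModels.Site 3)), Λ' ⊆ Λ → ∀ (β : ℝ) (ρ : (↥Λ → ℤˣ) → ℝ), (∀ i : ↥Λ, (i : Literature.Probability.LatticeModels.Site 3) ∈ Λ' → ∀ τ : ↥Λ → ℤˣ, ρ τ * Real.exp (-(β * Literature.Probability.LatticeModels.spinAt (i : Literature.Probability.LatticeModels.Site 3) (Literature.Probability.LatticeModels.glue Λ τ Literature.Probability.LatticeModels.BoundaryCondition.plus) * ∑ y ∈ (Literature.Probability.LatticeModels.zdGraph 3).neighborFinset (i : Literature.Probability.LatticeModels.Site 3), Literature.Probability.LatticeModels.spinAt y (Literature.Probability.LatticeModels.glue Λ τ Literature.Probability.LatticeModels.BoundaryCondition.plus))) = ρ (Function.update τ i (-τ i)) * Real.exp (β * Literature.Probability.LatticeModels.spinAt (i : Literature.Probability.LatticeModels.Site 3) (Literature.Probability.LatticeModels.glue Λ τ Literature.Probability.LatticeModels.BoundaryCondition.plus) * ∑ y ∈ (Literature.Probability.LatticeModels.zdGraph 3).neighborFinset (i : Literature.Probability.LatticeModels.Site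 3), Literature.Probability.LatticeModels.spinAt y (Literature.Probability.LatticeModels.glue Λ τ Literature.Probability.LatticeModels.BoundaryCondition.plus))) → ∀ g : Literature.Probability.LatticeModels.SpinConfig (Literature.Probability.LatticeModels.Site 3) → ℝ, Measurable g → ∑ τ : ↥Λ → ℤˣ, ρ τ * Literature.Probability.LatticeModels.isingExpect (Literature.Probability.LatticeModels.zdGraph 3) Λ' β 0 (Literature.Probability.LatticeModels.BoundaryCondition.fixed (Literature.Probability.LatticeModels.glue Λ τ Literature.Probability.LatticeModels.BoundaryCondition.plus)) g = ∑ τ : ↥Λ → ℤˣ, ρ τ * g (Literature.Probability.LatticeModels.glue Λ τ Literature.Probability.LatticeModels.BoundaryCondition.plus) :=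
  fun _ _ hsub β ρ hbal _ hg =>
    sum_mul_isingExpect_fixed_eq_of_balance (Literature.Probability.LatticeModels.zdGraph 3) hsub β ρ
      hbal hg

end Summit.CriticalPhenomena.Ising3DConformalLimit.Theorems

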